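import Mathlib
import Summits.NavierStokesRegularity.NavierStokesRegularity.Theorems.FilamentSkeletonRssKelvinGateFreeResolventWeighted
import Summits.NavierStokesRegularity.NavierStokesRegularity.Theorems.FilamentSkeletonRssKelvinGateFreeResolventC0Div
import Summits.NavierStokesRegularity.NavierStokesRegularity.Theorems.FilamentSkeletonRssKelvinGateProjectedDatumG

/-!
# Route `FilamentSkeletonRss` · crux `TransverseReduction1A` (stmt-27414; successor of the aside `TransverseReductionRJ`,
# stmt-21221) — line `kelvin_gate`: **THE FREE KELVIN GATE IN THE SHARP SCALES** (base `U⁰ = 0`, every rate `α`, ALL data)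

Helper file (theorems only, `--as helper`).  HONEST FRAMING: analysis bookkeeping for a HYPOTHETICAL filament-type rotating
self-similar blow-up route; nothing here bears on Navier–Stokes regularity; no stub is proved here; `TransverseReduction1A`
is neither proved nor refuted by this file.

Design memo SHARP-WEIGHTS-DESIGN-21221-g7 proposed re-typed gate scales in which the free gate closes by kernel-size potential
bounds and weighted Hölder heat gains, with NO Calderón–Zygmund step.  With the internal weight `a ∈ (1, 2)`:

  `Y♯_a`:  `F ∈ C¹`,  `(1+|y|)^{a+1} ‖F‖ ≤ R`,  `(1+|y|)^{a+1} ‖DF‖ ≤ R`;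
  `X♯_a`:  `W ∈ C²`,  `(1+|y|) ‖W‖ ≤ C R`,  `(1+|y|)^a ‖DW‖ ≤ C R`,  `(1+|y|)^a ‖D²W‖ ≤ C R`

(the bilinear profile term `DW[W′]` maps `X♯_a × X♯_a → Y♯_a` since `2a ≥ a + 1`).  This file assembles the kernel-checked chain
m1–m5 into the theorem:

* `free_kelvin_gate_sharp` — for `1 < a < 2` there is `C ≥ 0` such that for EVERY rate `α` and EVERY `F ∈ Y♯_a` the explicit pair
  `Q = Σⱼ T_{eⱼ}Fⱼ` (free pressure, `…FreePressure`),
  `W = ∫₀^∞ (e^{-s/2}R_{−αs})(e^{(1−e^{-s})Δ}(F − ∇Q))(e^{-s/2}R_{αs}·) ds` (free OU resolvent of the projected datum)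
  satisfies: `W ∈ C²` with the three `X♯_a` bounds, `div W = 0`, `Q ∈ C¹`, `|Q| ≤ C R`, `(1+|y|)^a ‖∇Q‖ ≤ C R`, and the FREE
  LINEARISED PROFILE EQUATION WITH PRESSURE  `𝓛_(α,0) W + ∇Q = F`  pointwise (`𝓛_(α,0) = Theorems.KelvinGate.lerayLin α 0`);
* `free_kelvin_gate_sharp_exists` — the same as an existence statement.

Uniqueness in these classes is `…KelvinGateFreeKernel` (g6).  What is NOT here: the gate at a non-trivial base `U⁰` (compact
perturbation `DW[U⁰] + DU⁰[W]`, Kelvin modes, the free rotation rate) — that is the crux.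
-/

set_option linter.dupNamespace false

noncomputable section

namespace Summit.NavierStokesRegularity.NavierStokesRegularity.Theorems.KelvinGate

open Set Function Filter Topology InnerProductSpace MeasureTheory Real Metric
open Literature.Analysis.FluidPDE Literature.Analysis.FluidPDE.NewtonPotentialHolder Literature.Analysis.UnboundedOperators
open scoped Laplacian RealInnerProductSpace ContDiff Topology ENNReal BigOperators

/-- The free OU resolvent of weight-`a` data that is moreover WEAKLY divergence free is divergence free (the domination `b₁` of
`…FreeResolventWeighted` made explicit for `…FreeResolventC0Div`). -/
theorem isDivFree_freeResolvent_weighted {a : ℝ} (ha1 : 1 < a) (ha2 : a < 2) (α : ℝ)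
    {G : EuclideanSpace ℝ (Fin 3) → EuclideanSpace ℝ (Fin 3)} (hG : Continuous G) {A₀ : ℝ}
    (h0 : ∀ z, (1 + ‖z‖) ^ a * ‖G z‖ ≤ A₀) (hdiv : IsWeaklyDivFree G) :
    VectorCalculus.IsDivFree (fun y => ∫ s in Ioi (0:ℝ), (Real.exp (-(s / 2)) • rotZL (-(α * s)))
        (heatExtension G (1 - Real.exp (-s)) ((Real.exp (-(s / 2)) • rotZL (α * s)) y))) := by
  have ha0 : 0 ≤ a := by linarith
  obtain ⟨C_T, hCT0, hT⟩ := weightK_heat_toolkit (E := EuclideanSpace ℝ (Fin 3)) (F := EuclideanSpace ℝ (Fin 3))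
    (k := a) (β := 1 / 2) ha1.le ha2.le (by norm_num) (by norm_num)
  obtain ⟨hC, -⟩ := norm_le_and_nonneg_of_rpow_weight ha0 h0
  have hGr : ∀ ⦃t : ℝ⦄, 0 < t → t ≤ 1 → ∀ x, (1 + ‖x‖) ^ a * ‖fderiv ℝ (heatExtension G t) x‖ ≤
      C_T * t ^ (-(1 / 2 : ℝ)) * A₀ := fun t ht ht1 => (hT G hG A₀ h0 ht ht1).2.1
  have hb₁ : IntegrableOn (fun s : ℝ => C_T * A₀ * (exp (-s) * (1 + s ^ (-(1 / 2 : ℝ))))) (Ioi 0) := by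
    have h := integrableOn_exp_neg_mul_one_add_rpow_neg (b := 1) (p := 1 / 2) one_pos (by norm_num)
    exact (h.congr_fun (fun s _ => by rw [one_mul]) measurableSet_Ioi).const_mul _
  have hD1 := fun s (hs : 0 < s) y => norm_fderiv_freeSlice_le_uniform ha0 hG h0 hGr α hs y
  exact isDivFree_freeResolvent_of_dominated hG hC hb₁ hD1 hdiv

/-- **THE FREE KELVIN GATE IN THE SHARP SCALES (explicit form).**  See the module docstring: `Q` = free pressure of `F`,
`W` = free OU resolvent of `F − ∇Q`; `W ∈ X♯_a`, `div W = 0`, `Q ∈ C¹` bounded with `(1+|y|)^a ‖∇Q‖ ≤ C R`, and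
`𝓛_(α,0) W + ∇Q = F`, with ONE constant `C = C(a)` for all rates `α` and all `F ∈ Y♯_a`. -/
theorem free_kelvin_gate_sharp {a : ℝ} (ha1 : 1 < a) (ha2 : a < 2) :
    ∃ C : ℝ, 0 ≤ C ∧ ∀ (α : ℝ) (F : EuclideanSpace ℝ (Fin 3) → EuclideanSpace ℝ (Fin 3)) (R : ℝ), ContDiff ℝ 1 F →
      (∀ y, (1 + ‖y‖) ^ (a + 1) * ‖F y‖ ≤ R) → (∀ y, (1 + ‖y‖) ^ (a + 1) * ‖fderiv ℝ F y‖ ≤ R) →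
      ContDiff ℝ 2 (fun y => ∫ s in Ioi (0:ℝ), (Real.exp (-(s / 2)) • rotZL (-(α * s)))
          (heatExtension (fun x => F x - gradient (fun x => ∑ j : Fin 3,
            newtonGradPotential (EuclideanSpace.single j (1:ℝ)) (fun y => F y j) x) x)
            (1 - Real.exp (-s)) ((Real.exp (-(s / 2)) • rotZL (α * s)) y))) ∧
      VectorCalculus.IsDivFree (fun y => ∫ s in Ioi (0:ℝ), (Real.exp (-(s / 2)) • rotZL (-(α * s)))
          (heatExtension (fun x => F x - gradient (fun x => ∑ j : Fin 3,
            newtonGradPotential (EuclideanSpace.single j (1:ℝ)) (fun y => F y j) x) x)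
            (1 - Real.exp (-s)) ((Real.exp (-(s / 2)) • rotZL (α * s)) y))) ∧
      (∀ y, (1 + ‖y‖) * ‖∫ s in Ioi (0:ℝ), (Real.exp (-(s / 2)) • rotZL (-(α * s)))
          (heatExtension (fun x => F x - gradient (fun x => ∑ j : Fin 3,
            newtonGradPotential (EuclideanSpace.single j (1:ℝ)) (fun y => F y j) x) x)
            (1 - Real.exp (-s)) ((Real.exp (-(s / 2)) • rotZL (α * s)) y))‖ ≤ C * R) ∧
      (∀ y, (1 + ‖y‖) ^ a * ‖fderiv ℝ (fun y => ∫ s in Ioi (0:ℝ), (Real.exp (-(s / 2)) • rotZL (-(α * s)))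
          (heatExtension (fun x => F x - gradient (fun x => ∑ j : Fin 3,
            newtonGradPotential (EuclideanSpace.single j (1:ℝ)) (fun y => F y j) x) x)
            (1 - Real.exp (-s)) ((Real.exp (-(s / 2)) • rotZL (α * s)) y))) y‖ ≤ C * R) ∧
      (∀ y, (1 + ‖y‖) ^ a * ‖fderiv ℝ (fderiv ℝ (fun y => ∫ s in Ioi (0:ℝ), (Real.exp (-(s / 2)) • rotZL (-(α * s)))
          (heatExtension (fun x => F x - gradient (fun x => ∑ j : Fin 3,
            newtonGradPotential (EuclideanSpace.single j (1:ℝ)) (fun y => F y j) x) x)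
            (1 - Real.exp (-s)) ((Real.exp (-(s / 2)) • rotZL (α * s)) y)))) y‖ ≤ C * R) ∧
      ContDiff ℝ 1 (fun x => ∑ j : Fin 3, newtonGradPotential (EuclideanSpace.single j (1:ℝ)) (fun y => F y j) x) ∧
      (∀ x, |∑ j : Fin 3, newtonGradPotential (EuclideanSpace.single j (1:ℝ)) (fun y => F y j) x| ≤ C * R) ∧
      (∀ x, (1 + ‖x‖) ^ a * ‖gradient (fun x => ∑ j : Fin 3,
        newtonGradPotential (EuclideanSpace.single j (1:ℝ)) (fun y => F y j) x) x‖ ≤ C * R) ∧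
      (∀ y, lerayLin α (fun _ => 0) (fun y => ∫ s in Ioi (0:ℝ), (Real.exp (-(s / 2)) • rotZL (-(α * s)))
          (heatExtension (fun x => F x - gradient (fun x => ∑ j : Fin 3,
            newtonGradPotential (EuclideanSpace.single j (1:ℝ)) (fun y => F y j) x) x)
            (1 - Real.exp (-s)) ((Real.exp (-(s / 2)) • rotZL (α * s)) y))) y +
        gradient (fun x => ∑ j : Fin 3, newtonGradPotential (EuclideanSpace.single j (1:ℝ)) (fun y => F y j) x) y = F y) := by
  obtain ⟨C_P, hCP0, hP⟩ := projected_datum ha1 ha2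
  obtain ⟨C_R, hCR0, hRes⟩ := free_resolvent_weighted (β := 1 / 2) ha1 ha2 (by norm_num) (by norm_num)
  refine ⟨C_P + 2 * C_R * C_P, by positivity, ?_⟩
  intro α F R hF h0 h1
  have hR : 0 ≤ R := le_trans (by positivity) (h0 0)
  obtain ⟨hQ1, hQb, hDQ, hGc, hG0, hG1, hGdiv⟩ := hP F R hF h0 h1
  -- the resolvent on the projected datum, with `A₀ = A₁ = C_P R`, `β = ½`
  have hA : 0 ≤ C_P * R := by positivity
  obtain ⟨hW2, hW0, hW1, hW2b, hWeq⟩ := hRes α _ hGc (C_P * R) (C_P * R) hA hG0 hG1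
  have hc1 : C_P * R ≤ (C_P + 2 * C_R * C_P) * R := by nlinarith [mul_nonneg (mul_nonneg hCR0 hCP0) hR]
  have hc2 : C_R * (C_P * R) ≤ (C_P + 2 * C_R * C_P) * R := by nlinarith [mul_nonneg (mul_nonneg hCR0 hCP0) hR, mul_nonneg hCP0 hR]
  have hc3 : C_R * (C_P * R + C_P * R) ≤ (C_P + 2 * C_R * C_P) * R := by nlinarith [mul_nonneg hCP0 hR]
  refine ⟨hW2, isDivFree_freeResolvent_weighted ha1 ha2 α hGc hG0 hGdiv, fun y => (hW0 y).trans hc2,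
    fun y => (hW1 y).trans hc2, fun y => (hW2b y).trans hc3, hQ1, fun x => (hQb x).trans hc1, fun x => (hDQ x).trans hc1,
    fun y => ?_⟩
  rw [hWeq y, sub_add_cancel]

/-- **THE FREE KELVIN GATE IN THE SHARP SCALES (existence form).**  For `1 < a < 2` there is `C ≥ 0` such that for every rate
`α` and every `F ∈ C¹` with `(1+|y|)^{a+1}‖F‖, (1+|y|)^{a+1}‖DF‖ ≤ R` there are `W ∈ C²`, `Q ∈ C¹` with `div W = 0`,
`(1+|y|)‖W‖, (1+|y|)^a‖DW‖, (1+|y|)^a‖D²W‖ ≤ C R`, `|Q| ≤ C R`, `(1+|y|)^a‖∇Q‖ ≤ C R` and `𝓛_(α,0) W + ∇Q = F`. -/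
theorem free_kelvin_gate_sharp_exists {a : ℝ} (ha1 : 1 < a) (ha2 : a < 2) :
    ∃ C : ℝ, 0 ≤ C ∧ ∀ (α : ℝ) (F : EuclideanSpace ℝ (Fin 3) → EuclideanSpace ℝ (Fin 3)) (R : ℝ), ContDiff ℝ 1 F →
      (∀ y, (1 + ‖y‖) ^ (a + 1) * ‖F y‖ ≤ R) → (∀ y, (1 + ‖y‖) ^ (a + 1) * ‖fderiv ℝ F y‖ ≤ R) →
      ∃ (W : EuclideanSpace ℝ (Fin 3) → EuclideanSpace ℝ (Fin 3)) (Q : EuclideanSpace ℝ (Fin 3) → ℝ),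
        ContDiff ℝ 2 W ∧ ContDiff ℝ 1 Q ∧ VectorCalculus.IsDivFree W ∧
        (∀ y, (1 + ‖y‖) * ‖W y‖ ≤ C * R) ∧ (∀ y, (1 + ‖y‖) ^ a * ‖fderiv ℝ W y‖ ≤ C * R) ∧
        (∀ y, (1 + ‖y‖) ^ a * ‖fderiv ℝ (fderiv ℝ W) y‖ ≤ C * R) ∧
        (∀ y, |Q y| ≤ C * R) ∧ (∀ y, (1 + ‖y‖) ^ a * ‖gradient Q y‖ ≤ C * R) ∧
        (∀ y, lerayLin α (fun _ => 0) W y + gradient Q y = F y) := by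
  obtain ⟨C, hC0, h⟩ := free_kelvin_gate_sharp ha1 ha2
  refine ⟨C, hC0, fun α F R hF h0 h1 => ?_⟩
  obtain ⟨hW2, hdiv, hW0, hW1, hW2b, hQ1, hQb, hDQ, heq⟩ := h α F R hF h0 h1
  exact ⟨_, _, hW2, hQ1, hdiv, hW0, hW1, hW2b, hQb, hDQ, heq⟩

end Summit.NavierStokesRegularity.NavierStokesRegularity.Theorems.KelvinGate

end
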